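import Mathlib

/-!
# Route `FilamentSkeletonRss` · child crux `TangentSkeletonNearStraightL` (stmt-NavierStokesRegularity-23320) · registered line
# `child_tangent_analytic_strip_L` (b0b56c52900dd90a), stub `stub_stripPropagation` — brick: TWO-LEVEL STEP PROFILES AND THEIR DOUBLE MEANS

The pair-averaging principle (`Theorems.StadiumPairAveraging`, integrable form) turns a pointwise pair profile `φ(r,r′)` into the bound
`1 − ∫₀¹∫₀¹ φ ≤ Re P`; the quarter-width corner assembly feeds it RIEMANN UPPER SUMS of the transcendental deviation profiles, i.e. STEP
majorants.  The simplest case already decides the left plateau at the registered output corner: a two-level real-deviation majorant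
`e = E₁` on the near half of the chord (disc ratio ≥ 3), `e = E₂` on the far half (ratio ≥ 4), with the pair profile
`φ(r,r′) = (ρ + e(r) + e(r′))²/2` of `Theorems.StadiumPairPositivity.re_dot_ge_of_le`.  This file provides, for the step
`e(r) = if r ≤ 1/2 then E₁ else E₂`:
* `step2_inner_eq` — `∫₀¹ (ρ + c + e(r′))²/2 dr′ = ((ρ + c + E₁)² + (ρ + c + E₂)²)/4` and its interval-integrability;
* `step2_double_mean_eq` — `∫₀¹∫₀¹ (ρ + e(r) + e(r′))²/2 = ((ρ+2E₁)² + 2(ρ+E₁+E₂)² + (ρ+2E₂)²)/8`, with the integrability facts the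
  integrable pair-averaging lemma asks for;
* `corner_left_double_mean_lt_one` — with `ρ = 1/2`, `E₁ = 1/2 ≥ 4√3(log(3/2) − 1/3)` (disc ratio 3) and `E₂ = 27/100 ≥
  4√3(log(3.96/2.96) − 1/3.96)` (disc ratio 3.96), cf. `Theorems.StadiumLogBounds`: the double mean is `< 0.82 < 1` — where the sup form
  `(ρ+2E₁)²/2 = 1.125` fails.
HONEST FRAMING: elementary real analysis for a plan about a HYPOTHETICAL filament skeleton on the NEGATIVE side of a MODEL route; the stub
`stub_stripPropagation` is NOT closed by this file; nothing here bears on Navier–Stokes regularity or blow-up.  `--supports stmt-NavierStokesRegularity-23320`.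
-/

set_option linter.dupNamespace false

noncomputable section

namespace Summit.NavierStokesRegularity.NavierStokesRegularity.Theorems.StadiumStepProfile

open Set MeasureTheory

/-- The two-level step profile on `[0,1]`: `E₁` on `[0, 1/2]`, `E₂` on `(1/2, 1]`. -/
theorem step2_le_half {E₁ E₂ r : ℝ} (hr : r ≤ 1 / 2) : (if r ≤ 1 / 2 then E₁ else E₂) = E₁ := if_pos hr

/-- The two-level step profile beyond the midpoint. -/
theorem step2_gt_half {E₁ E₂ r : ℝ} (hr : 1 / 2 < r) : (if r ≤ 1 / 2 then E₁ else E₂) = E₂ := if_neg (not_le.2 hr)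

/-- A function that is constant on `Ioc a b` (`a ≤ b`) is interval-integrable there with integral `(b − a)·c`. [folklore] -/
theorem intervalIntegral_of_eqOn_Ioc {f : ℝ → ℝ} {a b c : ℝ} (hab : a ≤ b) (h : ∀ x ∈ Ioc a b, f x = c) :
    IntervalIntegrable f volume a b ∧ ∫ x in a..b, f x = (b - a) * c := by
  have hae : ∀ᵐ x ∂volume, x ∈ Set.uIoc a b → f x = (fun _ => c) x := by
    refine Filter.Eventually.of_forall fun x hx => ?_
    rw [uIoc_of_le hab] at hx
    exact h x hx
  have hint : IntervalIntegrable f volume a b := by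
    have hc : IntervalIntegrable (fun _ : ℝ => c) volume a b := intervalIntegrable_const
    rw [intervalIntegrable_iff] at hc ⊢
    refine hc.congr_fun_ae ?_
    rw [Filter.EventuallyEq, ae_restrict_iff' measurableSet_uIoc]
    exact hae.mono fun x hx hx' => (hx hx').symm
  refine ⟨hint, ?_⟩
  rw [intervalIntegral.integral_congr_ae hae, intervalIntegral.integral_const, smul_eq_mul]

/-- **Inner integral of the two-level pair profile.**  For constants `ρ, c, E₁, E₂`:
`r′ ↦ (ρ + c + e(r′))²/2` is interval-integrable on `[0,1]` and `∫₀¹ (ρ + c + e(r′))²/2 dr′ = ((ρ+c+E₁)² + (ρ+c+E₂)²)/4`. [folklore] -/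
theorem step2_inner_eq (ρ c E₁ E₂ : ℝ) :
    IntervalIntegrable (fun r' : ℝ => (ρ + c + (if r' ≤ 1 / 2 then E₁ else E₂)) ^ 2 / 2) volume 0 1 ∧
    ∫ r' in (0:ℝ)..1, (ρ + c + (if r' ≤ 1 / 2 then E₁ else E₂)) ^ 2 / 2 = ((ρ + c + E₁) ^ 2 + (ρ + c + E₂) ^ 2) / 4 := by
  set f : ℝ → ℝ := fun r' => (ρ + c + (if r' ≤ 1 / 2 then E₁ else E₂)) ^ 2 / 2 with hf
  have h1 := intervalIntegral_of_eqOn_Ioc (f := f) (a := 0) (b := 1 / 2) (c := (ρ + c + E₁) ^ 2 / 2) (by norm_num)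
    fun x hx => by simp only [hf, step2_le_half hx.2]
  have h2 := intervalIntegral_of_eqOn_Ioc (f := f) (a := 1 / 2) (b := 1) (c := (ρ + c + E₂) ^ 2 / 2) (by norm_num)
    fun x hx => by simp only [hf, step2_gt_half hx.1]
  refine ⟨h1.1.trans h2.1, ?_⟩
  rw [← intervalIntegral.integral_add_adjacent_intervals h1.1 h2.1, h1.2, h2.2]
  ring

/-- **Double mean of the two-level pair profile.**  With `e(r) = if r ≤ 1/2 then E₁ else E₂` and `φ(r,r′) = (ρ + e(r) + e(r′))²/2`:
`r′ ↦ φ(r,r′)` is interval-integrable for every `r`, `r ↦ ∫₀¹ φ(r,r′) dr′` is interval-integrable, and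
`∫₀¹∫₀¹ φ = ((ρ+2E₁)² + 2(ρ+E₁+E₂)² + (ρ+2E₂)²)/8`. [folklore] -/
theorem step2_double_mean_eq (ρ E₁ E₂ : ℝ) :
    (∀ r : ℝ, IntervalIntegrable
      (fun r' : ℝ => (ρ + (if r ≤ 1 / 2 then E₁ else E₂) + (if r' ≤ 1 / 2 then E₁ else E₂)) ^ 2 / 2) volume 0 1) ∧
    IntervalIntegrable (fun r : ℝ => ∫ r' in (0:ℝ)..1,
      (ρ + (if r ≤ 1 / 2 then E₁ else E₂) + (if r' ≤ 1 / 2 then E₁ else E₂)) ^ 2 / 2) volume 0 1 ∧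
    ∫ r in (0:ℝ)..1, ∫ r' in (0:ℝ)..1,
      (ρ + (if r ≤ 1 / 2 then E₁ else E₂) + (if r' ≤ 1 / 2 then E₁ else E₂)) ^ 2 / 2 =
      ((ρ + 2 * E₁) ^ 2 + 2 * (ρ + E₁ + E₂) ^ 2 + (ρ + 2 * E₂) ^ 2) / 8 := by
  have hinner : ∀ r : ℝ, ∫ r' in (0:ℝ)..1,
      (ρ + (if r ≤ 1 / 2 then E₁ else E₂) + (if r' ≤ 1 / 2 then E₁ else E₂)) ^ 2 / 2 =
      ((ρ + (if r ≤ 1 / 2 then E₁ else E₂) + E₁) ^ 2 + (ρ + (if r ≤ 1 / 2 then E₁ else E₂) + E₂) ^ 2) / 4 :=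
    fun r => (step2_inner_eq ρ _ E₁ E₂).2
  refine ⟨fun r => (step2_inner_eq ρ _ E₁ E₂).1, ?_, ?_⟩
  · -- the outer integrand is itself a two-level step function of `r`
    have hfun : (fun r : ℝ => ∫ r' in (0:ℝ)..1,
        (ρ + (if r ≤ 1 / 2 then E₁ else E₂) + (if r' ≤ 1 / 2 then E₁ else E₂)) ^ 2 / 2) =
        fun r => ((ρ + (if r ≤ 1 / 2 then E₁ else E₂) + E₁) ^ 2 + (ρ + (if r ≤ 1 / 2 then E₁ else E₂) + E₂) ^ 2) / 4 := by
      funext r; exact hinner r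
    rw [hfun]
    have h1 := intervalIntegral_of_eqOn_Ioc
      (f := fun r => ((ρ + (if r ≤ 1 / 2 then E₁ else E₂) + E₁) ^ 2 + (ρ + (if r ≤ 1 / 2 then E₁ else E₂) + E₂) ^ 2) / 4)
      (a := 0) (b := 1 / 2) (c := ((ρ + E₁ + E₁) ^ 2 + (ρ + E₁ + E₂) ^ 2) / 4) (by norm_num)
      fun x hx => by simp only [step2_le_half hx.2]
    have h2 := intervalIntegral_of_eqOn_Ioc
      (f := fun r => ((ρ + (if r ≤ 1 / 2 then E₁ else E₂) + E₁) ^ 2 + (ρ + (if r ≤ 1 / 2 then E₁ else E₂) + E₂) ^ 2) / 4)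
      (a := 1 / 2) (b := 1) (c := ((ρ + E₂ + E₁) ^ 2 + (ρ + E₂ + E₂) ^ 2) / 4) (by norm_num)
      fun x hx => by simp only [step2_gt_half hx.1]
    exact h1.1.trans h2.1
  · have hfun : (fun r : ℝ => ∫ r' in (0:ℝ)..1,
        (ρ + (if r ≤ 1 / 2 then E₁ else E₂) + (if r' ≤ 1 / 2 then E₁ else E₂)) ^ 2 / 2) =
        fun r => ((ρ + (if r ≤ 1 / 2 then E₁ else E₂) + E₁) ^ 2 + (ρ + (if r ≤ 1 / 2 then E₁ else E₂) + E₂) ^ 2) / 4 := by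
      funext r; exact hinner r
    rw [hfun]
    have h1 := intervalIntegral_of_eqOn_Ioc
      (f := fun r => ((ρ + (if r ≤ 1 / 2 then E₁ else E₂) + E₁) ^ 2 + (ρ + (if r ≤ 1 / 2 then E₁ else E₂) + E₂) ^ 2) / 4)
      (a := 0) (b := 1 / 2) (c := ((ρ + E₁ + E₁) ^ 2 + (ρ + E₁ + E₂) ^ 2) / 4) (by norm_num)
      fun x hx => by simp only [step2_le_half hx.2]
    have h2 := intervalIntegral_of_eqOn_Ioc
      (f := fun r => ((ρ + (if r ≤ 1 / 2 then E₁ else E₂) + E₁) ^ 2 + (ρ + (if r ≤ 1 / 2 then E₁ else E₂) + E₂) ^ 2) / 4)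
      (a := 1 / 2) (b := 1) (c := ((ρ + E₂ + E₁) ^ 2 + (ρ + E₂ + E₂) ^ 2) / 4) (by norm_num)
      fun x hx => by simp only [step2_gt_half hx.1]
    rw [← intervalIntegral.integral_add_adjacent_intervals h1.1 h2.1, h1.2, h2.2]
    ring

/-- **The left plateau at the registered output corner passes in the mean.**  With the tangent oscillation `ρ = 1/2` (the stub's `Rb ≤ 1/2`) and
the two corner levels `E₁ = 1/2` (disc ratio 3: `4√3(log(3/2) − 1/3) ≤ 0.49975`) and `E₂ = 27/100` (disc ratio `3.96`:
`4√3(log(3.96/2.96) − 1/3.96) ≤ 0.2675`), the double mean of `(ρ + e + e′)²/2` is `< 41/50 < 1` (the sup form gives `9/8`). [folklore] -/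
theorem corner_left_double_mean_lt_one :
    ((1 / 2 + 2 * (1 / 2 : ℝ)) ^ 2 + 2 * (1 / 2 + 1 / 2 + 27 / 100) ^ 2 + (1 / 2 + 2 * (27 / 100)) ^ 2) / 8 < 41 / 50 := by
  norm_num

end Summit.NavierStokesRegularity.NavierStokesRegularity.Theorems.StadiumStepProfile

end
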